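import Summits.Ventures.PackingBounds.SphericalCodes.TouchingTwoSpheres
import Summits.Ventures.PackingBounds.SphericalCodes.LevenshteinFourMinusOne
import Summits.Ventures.PackingBounds.SphericalCodes.LevenshteinFiveMinusOne
import Summits.Ventures.PackingBounds.Configurations.Dim22Card275
import Summits.Ventures.PackingBounds.Configurations.Dim23Card552
import Summits.Ventures.PackingBounds.Configurations.LeechCard4600
import Summits.Ventures.PackingBounds.Configurations.Dim22Card891

/-!
# Dimension lift with two poles: `A(n + 1, arccos s) ≥ A(n, arccos s) + 2` for `s ≥ 0`, and attained-side rows at `n = 23, 24`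

Framing: lottery ticket; floor = certified bounds/negative ranges. Venture `PackingBounds` (cell `pub-packcert`), spherical-codes
family; the ATTAINED side ('sharpness gap') of the large-`n` cells of the cell's table B2c, which so far carried no lower bound.

A code of unit vectors of `ℝⁿ` with pairwise inner products `≤ s`, `0 ≤ s`, put into the hyperplane `e₀^⊥` of `ℝⁿ⁺¹` by the
coordinate embedding (`exists_embed_succ`) and enlarged by the two poles `± e₀`, is a code of `ℝⁿ⁺¹` with the same angle and two
more points (`exists_code_lift_succ`): the new inner products are `0 ≤ s` and `-1 ≤ s`. From the tree's sharp Leech-lattice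
configurations (`A(22, arccos 1/6) = 275`, `A(22, arccos 1/4) = 891`, `A(23, arccos 1/5) = 552`, `A(23, arccos 1/3) = 4600`, all
two-sided kernel theorems of the cell) this gives the kernel lower bounds
`A(23, arccos 1/6) ≥ 277`, `A(24, arccos 1/6) ≥ 279`, `A(23, arccos 1/4) ≥ 893`, `A(24, arccos 1/5) ≥ 554`, `A(24, arccos 1/3) ≥ 4602`
for the B2c cells `(23, 1/6)`, `(24, 1/6)`, `(23, 1/4)`, `(24, 1/5)`, `(24, 1/3)` (certified upper values of the cell at the time of
writing: `306`, `340`, `—`, `609`, `5476`; kernel upper bounds in the tree: `A(23, arccos 1/6) ≤ 309` and `A(23, arccos 1/4) ≤ 1046`,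
Levenshtein `L₄ - 1` / `L₅ - 1` rows, giving the kernel brackets below). Elementary; no optimality claim for any lifted code.

## References
* J. H. Conway, N. J. A. Sloane, *Sphere Packings, Lattices and Groups*, 3rd ed., Ch. 1 §2.3, Ch. 9 §3, Ch. 14 Example 3.
  [`ConwaySloane1999`]
* H. Cohn, A. Kumar, J. Amer. Math. Soc. 20 (2007) 99–148, Table 1. [`CohnKumar2006`]
-/

noncomputable section

open Finset
open scoped RealInnerProductSpace

namespace Summit.Ventures.PackingBounds.SphericalCodes

/-- **Dimension lift with two poles.** A code of unit vectors of `ℝⁿ` with pairwise inner products `≤ s`, where `0 ≤ s`, yields a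
code of unit vectors of `ℝⁿ⁺¹` with pairwise inner products `≤ s` and exactly two more points (the embedded code in `e₀^⊥`
together with `± e₀`). Hence `A(n + 1, arccos s) ≥ A(n, arccos s) + 2` for `0 ≤ s < 1`. -/
theorem exists_code_lift_succ {n : ℕ} {s : ℝ} (hs : 0 ≤ s) (C : Finset (EuclideanSpace ℝ (Fin n)))
    (h1 : ∀ x ∈ C, ‖x‖ = 1) (h2 : ∀ x ∈ C, ∀ y ∈ C, x ≠ y → inner ℝ x y ≤ s) :
    ∃ C' : Finset (EuclideanSpace ℝ (Fin (n + 1))), C'.card = C.card + 2 ∧ (∀ x ∈ C', ‖x‖ = 1) ∧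
      (∀ x ∈ C', ∀ y ∈ C', x ≠ y → inner ℝ x y ≤ s) := by
  classical
  obtain ⟨ι, hip, hsub, he0⟩ := exists_embed_succ n
  set e : EuclideanSpace ℝ (Fin (n + 1)) := EuclideanSpace.single (0 : Fin (n + 1)) (1 : ℝ) with he
  have hee : inner ℝ e e = (1 : ℝ) := by
    rw [he, EuclideanSpace.inner_single_left]; simp
  have hne : ‖e‖ = 1 := by
    have h : ‖e‖ ^ 2 = 1 := by rw [← real_inner_self_eq_norm_sq, hee]
    nlinarith [norm_nonneg e]
  -- norms and inner products on the image
  have hnorm : ∀ x ∈ C, ‖ι x‖ = 1 := by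
    intro x hx
    have h : ‖ι x‖ ^ 2 = ‖x‖ ^ 2 := by
      rw [← real_inner_self_eq_norm_sq, ← real_inner_self_eq_norm_sq, hip]
    have h' : ‖ι x‖ ^ 2 = 1 := by rw [h, h1 x hx, one_pow]
    nlinarith [norm_nonneg (ι x)]
  have hinj : Set.InjOn ι ↑C := by
    intro x _ y _ hxy
    have h0 : ‖ι x - ι y‖ = 0 := by rw [hxy, sub_self, norm_zero]
    rw [hsub, ← sq_eq_zero_iff, ← real_inner_self_eq_norm_sq, hip, real_inner_self_eq_norm_sq, sq_eq_zero_iff,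
      norm_eq_zero, sub_eq_zero] at h0
    exact h0
  -- the poles are new points
  have he_notin : ∀ (σ : ℝ), σ = 1 ∨ σ = -1 → σ • e ∉ C.image ι := by
    intro σ hσ hmem
    obtain ⟨x, _, hx⟩ := mem_image.mp hmem
    have h0 : inner ℝ e (ι x) = 0 := he0 x
    rw [hx, real_inner_smul_right, hee, mul_one] at h0
    rcases hσ with rfl | rfl <;> norm_num at h0
  have hpm : e ≠ (-1 : ℝ) • e := by
    intro h
    have h' : inner ℝ e e = inner ℝ e ((-1 : ℝ) • e) := by rw [← h]
    rw [real_inner_smul_right, hee] at h'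
    norm_num at h'
  refine ⟨insert e (insert ((-1 : ℝ) • e) (C.image ι)), ?_, ?_, ?_⟩
  · -- cardinality
    have h1' : (-1 : ℝ) • e ∉ C.image ι := he_notin (-1) (Or.inr rfl)
    have h2' : e ∉ insert ((-1 : ℝ) • e) (C.image ι) := by
      rw [mem_insert, not_or]
      exact ⟨hpm, by simpa using he_notin 1 (Or.inl rfl)⟩
    rw [card_insert_of_notMem h2', card_insert_of_notMem h1', card_image_of_injOn hinj]
  · -- unit norms
    intro x hx
    rcases mem_insert.mp hx with rfl | hx
    · exact hne
    rcases mem_insert.mp hx with rfl | hx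
    · rw [norm_smul, hne]; norm_num
    · obtain ⟨y, hy, rfl⟩ := mem_image.mp hx
      exact hnorm y hy
  · -- inner products
    have hs1 : (-1 : ℝ) ≤ s := by linarith
    -- pole / image
    have hpole : ∀ (σ : ℝ) (z : EuclideanSpace ℝ (Fin (n + 1))), z ∈ C.image ι → inner ℝ (σ • e) z ≤ s := by
      intro σ z hz
      obtain ⟨x, _, rfl⟩ := mem_image.mp hz
      rw [real_inner_smul_left, he0 x, mul_zero]
      exact hs
    have hpole' : ∀ (σ : ℝ) (z : EuclideanSpace ℝ (Fin (n + 1))), z ∈ C.image ι → inner ℝ z (σ • e) ≤ s := by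
      intro σ z hz; rw [real_inner_comm]; exact hpole σ z hz
    intro x hx y hy hxy
    rcases mem_insert.mp hx with rfl | hx
    · rcases mem_insert.mp hy with rfl | hy
      · exact absurd rfl hxy
      rcases mem_insert.mp hy with rfl | hy
      · rw [real_inner_smul_right, hee]; linarith
      · simpa using hpole 1 y hy
    rcases mem_insert.mp hx with rfl | hx
    · rcases mem_insert.mp hy with rfl | hy
      · rw [real_inner_smul_left, hee]; linarith
      rcases mem_insert.mp hy with rfl | hy
      · exact absurd rfl hxy
      · exact hpole (-1) y hy
    · rcases mem_insert.mp hy with rfl | hy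
      · simpa using hpole' 1 x hx
      rcases mem_insert.mp hy with rfl | hy
      · exact hpole' (-1) x hx
      · obtain ⟨a, ha, rfl⟩ := mem_image.mp hx
        obtain ⟨b, hb, rfl⟩ := mem_image.mp hy
        rw [hip]
        exact h2 a ha b hb (fun h => hxy (by rw [h]))

/-! ## Attained-side rows for the cell's large-`n` B2c cells -/

/-- **`A(23, arccos 1/6) ≥ 277`**: the sharp `275`-point configuration of `ℝ²²` (McLaughlin; `Config.Dim22Card275`) lifted with
two poles. [cite: CohnKumar2006, Table 1] -/
theorem exists_code_dim23_sixth_277 : ∃ C : Finset (EuclideanSpace ℝ (Fin 23)),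
    C.card = 277 ∧ (∀ x ∈ C, ‖x‖ = 1) ∧ (∀ x ∈ C, ∀ y ∈ C, x ≠ y → inner ℝ x y ≤ 1 / 6) := by
  obtain ⟨C, hc, h1, h2⟩ := Config.Dim22Card275.exists_code_275
  obtain ⟨C', hc', h1', h2'⟩ := exists_code_lift_succ (by norm_num) C h1 h2
  exact ⟨C', by rw [hc', hc], h1', h2'⟩

/-- **Kernel bracket `277 ≤ A(23, arccos 1/6) ≤ 309`** (upper: Levenshtein `L₄ - 1` row `code_dim23_sixth_le_309`; the cell's
certified three-point value is lower but not a kernel theorem). -/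
theorem code_dim23_sixth_bracket :
    277 ∈ {N : ℕ | ∃ C : Finset (EuclideanSpace ℝ (Fin 23)), C.card = N ∧ (∀ x ∈ C, ‖x‖ = 1) ∧
      (∀ x ∈ C, ∀ y ∈ C, x ≠ y → inner ℝ x y ≤ 1 / 6)} ∧
    ∀ N ∈ {N : ℕ | ∃ C : Finset (EuclideanSpace ℝ (Fin 23)), C.card = N ∧ (∀ x ∈ C, ‖x‖ = 1) ∧
      (∀ x ∈ C, ∀ y ∈ C, x ≠ y → inner ℝ x y ≤ 1 / 6)}, N ≤ 309 := by
  refine ⟨exists_code_dim23_sixth_277, ?_⟩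
  rintro N ⟨C, rfl, h1, h2⟩
  exact code_dim23_sixth_le_309 C h1 h2

/-- **`A(24, arccos 1/6) ≥ 279`**: the `275`-point configuration lifted twice. [cite: CohnKumar2006, Table 1] -/
theorem exists_code_dim24_sixth_279 : ∃ C : Finset (EuclideanSpace ℝ (Fin 24)),
    C.card = 279 ∧ (∀ x ∈ C, ‖x‖ = 1) ∧ (∀ x ∈ C, ∀ y ∈ C, x ≠ y → inner ℝ x y ≤ 1 / 6) := by
  obtain ⟨C, hc, h1, h2⟩ := exists_code_dim23_sixth_277
  obtain ⟨C', hc', h1', h2'⟩ := exists_code_lift_succ (by norm_num) C h1 h2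
  exact ⟨C', by rw [hc', hc], h1', h2'⟩

/-- **`A(23, arccos 1/4) ≥ 893`**: the sharp `891`-point configuration of `ℝ²²` (`Config.Dim22Card891`) lifted with two poles.
[cite: CohnKumar2006, Table 1] -/
theorem exists_code_dim23_quarter_893 : ∃ C : Finset (EuclideanSpace ℝ (Fin 23)),
    C.card = 893 ∧ (∀ x ∈ C, ‖x‖ = 1) ∧ (∀ x ∈ C, ∀ y ∈ C, x ≠ y → inner ℝ x y ≤ 1 / 4) := by
  obtain ⟨C, hc, h1, h2⟩ := Config.Dim22Card891.exists_code_891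
  obtain ⟨C', hc', h1', h2'⟩ := exists_code_lift_succ (by norm_num) C h1 h2
  exact ⟨C', by rw [hc', hc], h1', h2'⟩

/-- **Kernel bracket `893 ≤ A(23, arccos 1/4) ≤ 1046`** (upper: Levenshtein `L₅ - 1` row `code_dim23_quarter_le_1046`). -/
theorem code_dim23_quarter_bracket :
    893 ∈ {N : ℕ | ∃ C : Finset (EuclideanSpace ℝ (Fin 23)), C.card = N ∧ (∀ x ∈ C, ‖x‖ = 1) ∧
      (∀ x ∈ C, ∀ y ∈ C, x ≠ y → inner ℝ x y ≤ 1 / 4)} ∧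
    ∀ N ∈ {N : ℕ | ∃ C : Finset (EuclideanSpace ℝ (Fin 23)), C.card = N ∧ (∀ x ∈ C, ‖x‖ = 1) ∧
      (∀ x ∈ C, ∀ y ∈ C, x ≠ y → inner ℝ x y ≤ 1 / 4)}, N ≤ 1046 := by
  refine ⟨exists_code_dim23_quarter_893, ?_⟩
  rintro N ⟨C, rfl, h1, h2⟩
  exact code_dim23_quarter_le_1046 C h1 h2

/-- **`A(24, arccos 1/5) ≥ 554`**: the sharp `552`-point configuration of `ℝ²³` (`Config.Dim23Card552`) lifted with two poles.
[cite: CohnKumar2006, Table 1] -/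
theorem exists_code_dim24_fifth_554 : ∃ C : Finset (EuclideanSpace ℝ (Fin 24)),
    C.card = 554 ∧ (∀ x ∈ C, ‖x‖ = 1) ∧ (∀ x ∈ C, ∀ y ∈ C, x ≠ y → inner ℝ x y ≤ 1 / 5) := by
  obtain ⟨C, hc, h1, h2⟩ := Config.Dim23Card552.exists_code_552
  obtain ⟨C', hc', h1', h2'⟩ := exists_code_lift_succ (by norm_num) C h1 h2
  exact ⟨C', by rw [hc', hc], h1', h2'⟩

/-- **`A(24, arccos 1/3) ≥ 4602`**: the `4600` Leech neighbours (`Config.Leech.exists_code_4600`, `A(23, arccos 1/3) = 4600`)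
lifted with two poles. [cite: ConwaySloane1999, Ch. 14 Example 3] -/
theorem exists_code_dim24_third_4602 : ∃ C : Finset (EuclideanSpace ℝ (Fin 24)),
    C.card = 4602 ∧ (∀ x ∈ C, ‖x‖ = 1) ∧ (∀ x ∈ C, ∀ y ∈ C, x ≠ y → inner ℝ x y ≤ 1 / 3) := by
  obtain ⟨C, hc, h1, h2⟩ := Config.Leech.exists_code_4600
  obtain ⟨C', hc', h1', h2'⟩ := exists_code_lift_succ (by norm_num) C h1 h2
  exact ⟨C', by rw [hc', hc], h1', h2'⟩

end Summit.Ventures.PackingBounds.SphericalCodes
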